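import Summits.PneNP.PneNP.Theorems.PstarSAPeeling
import Summits.PneNP.PneNP.Theorems.PairwiseSALevel

/-!
# Biased pairwise-independent Sherali–Adams laws for `k`-local maps, I: local factors and the peeling identity (T22.0 hub)

FRONTIER range-avoidance ladder, rung F-N3 context — restricted-model lower-bound bookkeeping for the Sherali–Adams hierarchy
(`PstarSALevel.SAFeasible`); cell `pnp-ideate`, ROUND-22 item T22.0 ("abstract biased BGMT").  Nothing here bears on `P` vs `NP`.

This is the `k`-ary, law-abstract form of `PstarSAPeeling` (which is the case `k = 4`, laws `PstarPairwise.lp (√2/2) (y j)`,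
biases `½ / √2/2` by type).  Data: a `k`-local map `I` with injective slots, a target `y`, VARIABLE BIASES `p : Fin n → ℝ` in
`(0,1)` and per-output LAWS `µ j` on slot patterns `Fin k → Bool` that are supported on the fibre `{u | I.table j u = y j}`,
have slot marginals `ρ_{p(vars j s)}` (bias consistency — the role typedness played for `P⋆`) and are PAIRWISE INDEPENDENT
(`PairwiseSALevel.PairwiseLaws`, the cell's T22.0 target file).  Then (Benabbas–Georgiou–Magen–Tulsiani 2012 §3.2 with
balance replaced by bias consistency):

* `sum_fix` — with at most two slots fixed, the mass of `µ j` on the compatible patterns is the product of the slot biases;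
* `sum_cylOff_mu` — **the peeling identity**: summing the local factor of output `j₀` over a cylinder free on all but at most
  two of its variables leaves the product of the biases of the remaining variables.

Parts II/III (`PairwiseSAPeelStep`, `PairwiseSAConsistency`) repeat the reweighted-law construction, the one-constraint peel
with `≥ k − 2` private variables, and BGMT Lemma 3.2 / normalisation, verbatim from the `P⋆` files.
-/

set_option linter.dupNamespace false

open Finset Literature.Computability.Complexity
open Summit.PneNP.PneNP.Theorems.PstarPairwise (rho)
open Summit.PneNP.PneNP.Theorems.PstarSALevel (varSet)
open Summit.PneNP.PneNP.Theorems.PstarSAPeeling (cylOff mem_cylOff sum_rho)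
open Summit.PneNP.PneNP.Theorems.PairwiseSALevel (marg1 marg2 PairwiseLaws)

namespace Summit.PneNP.PneNP.Theorems.PairwiseSA

variable {k n m : ℕ}

/-! ## Slot marginals with at most two slots fixed -/

/-- Both weights of a bias in `(0,1)` are positive. -/
theorem rho_pos_of {q : ℝ} (h0 : 0 < q) (h1 : q < 1) (b : Bool) : 0 < rho q b := by
  unfold rho
  split_ifs <;> linarith

/-- The one-slot marginals add up to the total mass. -/
theorem marg1_add (w : (Fin k → Bool) → ℝ) (s : Fin k) : marg1 w s true + marg1 w s false = ∑ u, w u := by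
  unfold PairwiseSALevel.marg1
  rw [← sum_add_distrib]
  refine sum_congr rfl fun u _ => ?_
  cases u s <;> simp

/-- A law with bias marginals has total mass `1` (if `k ≥ 1`). -/
theorem total_of_marg {w : (Fin k → Bool) → ℝ} {q : Fin k → ℝ} (hmar : ∀ s b, marg1 w s b = rho (q s) b) (s : Fin k) :
    ∑ u, w u = 1 := by
  rw [← marg1_add w s, hmar, hmar, PstarSAPeeling.rho_add]

/-- **Slot marginals are products**: fixing at most two slots `Q`, the mass of the compatible patterns is the product of the
slot biases (total mass / one-slot marginal / pairwise independence). -/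
theorem sum_fix {w : (Fin k → Bool) → ℝ} {q : Fin k → ℝ} (htot : ∑ u, w u = 1) (hmar : ∀ s b, marg1 w s b = rho (q s) b)
    (hind : ∀ s s' : Fin k, s ≠ s' → ∀ α β : Bool, marg2 w s s' α β = marg1 w s α * marg1 w s' β)
    (Q : Finset (Fin k)) (hQ : Q.card ≤ 2) (u₀ : Fin k → Bool) :
    ∑ u ∈ univ.filter (fun u : Fin k → Bool => ∀ i ∈ Q, u i = u₀ i), w u = ∏ i ∈ Q, rho (q i) (u₀ i) := by
  rcases Nat.lt_or_ge Q.card 1 with h | h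
  · have hQ0 : Q = ∅ := Finset.card_eq_zero.1 (show Q.card = 0 by omega)
    subst hQ0
    rw [prod_empty]
    have e : univ.filter (fun u : Fin k → Bool => ∀ i ∈ (∅ : Finset (Fin k)), u i = u₀ i) = univ :=
      filter_true_of_mem fun u _ => by simp
    rw [e]
    exact htot
  rcases Nat.lt_or_ge Q.card 2 with h2 | h2
  · obtain ⟨i, rfl⟩ := Finset.card_eq_one.1 (show Q.card = 1 by omega)
    rw [prod_singleton, ← hmar, PairwiseSALevel.marg1, sum_filter]
    refine sum_congr rfl fun u _ => ?_
    simp only [mem_singleton, forall_eq]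
  · obtain ⟨i, j, hij, rfl⟩ := Finset.card_eq_two.1 (show Q.card = 2 by omega)
    rw [prod_pair hij, ← hmar, ← hmar, ← hind i j hij, PairwiseSALevel.marg2, sum_filter]
    refine sum_congr rfl fun u _ => ?_
    simp only [mem_insert, mem_singleton, forall_eq_or_imp, forall_eq]

/-! ## Transport along the positions of one output -/

/-- **Transport**: a cylinder sum of a function of the slot pattern of `e` (free set `F` inside the image of the injective
`e`) is the slot-pattern sum with the slots outside `F` fixed. -/
theorem sum_cylOff_comp {e : Fin k → Fin n} (he : Function.Injective e) {F : Finset (Fin n)} (hF : F ⊆ univ.image e)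
    (x : Fin n → Bool) (f : (Fin k → Bool) → ℝ) :
    ∑ β ∈ cylOff F x, f (fun s => β (e s)) =
      ∑ u ∈ univ.filter (fun u : Fin k → Bool => ∀ s ∈ univ.filter (fun s => e s ∉ F), u s = x (e s)), f u := by
  classical
  have hsl : ∀ {v}, v ∈ F → ∃ s, e s = v := fun hv => by
    obtain ⟨s, -, hs⟩ := mem_image.1 (hF hv)
    exact ⟨s, hs⟩
  let ψ : (Fin k → Bool) → (Fin n → Bool) := fun u v => if hv : v ∈ F then u (hsl hv).choose else x v
  refine Finset.sum_nbij' (fun β s => β (e s)) ψ ?_ ?_ ?_ ?_ (fun _ _ => rfl)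
  · intro β hβ
    rw [mem_cylOff] at hβ
    simp only [mem_filter, mem_univ, true_and]
    intro s hs
    exact hβ _ hs
  · intro u _
    rw [mem_cylOff]
    intro v hv
    simp only [ψ, dif_neg hv]
  · intro β hβ
    rw [mem_cylOff] at hβ
    funext v
    simp only [ψ]
    split_ifs with hv
    · rw [(hsl hv).choose_spec]
    · exact (hβ v hv).symm
  · intro u hu
    simp only [mem_filter, mem_univ, true_and] at hu
    funext s
    simp only [ψ]
    split_ifs with hv
    · exact congrArg u (he (hsl hv).choose_spec)
    · exact (hu s hv).symm

/-- The slots of `j₀` reading a variable of `F ⊆ varSet j₀` are as many as `F`. -/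
theorem card_slots_mem {I : LocalMap k n m} {j₀ : Fin m} (hinj : Function.Injective (I.vars j₀)) {F : Finset (Fin n)}
    (hF : F ⊆ varSet I j₀) : (univ.filter fun s => I.vars j₀ s ∈ F).card = F.card := by
  have himg : (univ.filter fun s => I.vars j₀ s ∈ F).image (I.vars j₀) = F := by
    ext v
    simp only [mem_image, mem_filter, mem_univ, true_and]
    constructor
    · rintro ⟨s, hs, rfl⟩; exact hs
    · intro hv
      obtain ⟨s, -, hs⟩ := mem_image.1 (hF hv)
      exact ⟨s, by rw [hs]; exact hv, hs⟩
  calc (univ.filter fun s => I.vars j₀ s ∈ F).card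
      = ((univ.filter fun s => I.vars j₀ s ∈ F).image (I.vars j₀)).card := (card_image_of_injective _ hinj).symm
    _ = F.card := by rw [himg]

/-- Hence the slots of `j₀` NOT reading into `F` number `k − #F`. -/
theorem card_slots_not_mem {I : LocalMap k n m} {j₀ : Fin m} (hinj : Function.Injective (I.vars j₀))
    {F : Finset (Fin n)} (hF : F ⊆ varSet I j₀) : (univ.filter fun s => I.vars j₀ s ∉ F).card = k - F.card := by
  have h := Finset.card_filter_add_card_filter_not (s := (univ : Finset (Fin k))) (fun s => I.vars j₀ s ∈ F)
  rw [card_slots_mem hinj hF, card_univ, Fintype.card_fin] at h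
  omega

/-- The variables read by the slots not reading into `F` are `varSet j₀ \ F`. -/
theorem image_slots_not_mem (I : LocalMap k n m) (j₀ : Fin m) (F : Finset (Fin n)) :
    (univ.filter fun s => I.vars j₀ s ∉ F).image (I.vars j₀) = varSet I j₀ \ F := by
  ext v
  simp only [mem_image, mem_filter, mem_univ, true_and, mem_sdiff, PstarSALevel.varSet]
  constructor
  · rintro ⟨s, hs, rfl⟩
    exact ⟨⟨s, rfl⟩, hs⟩
  · rintro ⟨⟨s, rfl⟩, hv⟩
    exact ⟨s, hv, rfl⟩

/-! ## Local factors and the peeling identity -/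

/-- The LOCAL FACTOR of output `j`: its law read through its positions at a full assignment. -/
def mu (I : LocalMap k n m) (μ : Fin m → (Fin k → Bool) → ℝ) (j : Fin m) (x : Fin n → Bool) : ℝ :=
  μ j (fun s => x (I.vars j s))

/-- The local factor of `j` only reads the variables of `j`. -/
theorem mu_congr (I : LocalMap k n m) (μ : Fin m → (Fin k → Bool) → ℝ) (j : Fin m) {β x : Fin n → Bool}
    (h : ∀ v ∈ varSet I j, β v = x v) : mu I μ j β = mu I μ j x := by
  unfold mu
  have e : (fun s => β (I.vars j s)) = fun s => x (I.vars j s) :=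
    funext fun s => h _ (mem_image_of_mem _ (mem_univ _))
  rw [e]

/-- **Support**: where the local factor of `j` is nonzero, output `j` takes the value `y j`. -/
theorem eval_eq_of_mu_ne_zero {I : LocalMap k n m} {y : Fin m → Bool} {p : Fin n → ℝ} {μ : Fin m → (Fin k → Bool) → ℝ}
    (h : PairwiseLaws I y p μ) {j : Fin m} {x : Fin n → Bool} (hx : mu I μ j x ≠ 0) : I.eval x j = y j :=
  h.support j _ hx

/-- **THE PEELING IDENTITY.**  Summing the local factor of output `j₀` over a cylinder free on all but at most two of its own
variables leaves the product of the biases of its remaining variables. -/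
theorem sum_cylOff_mu {I : LocalMap k n m} {y : Fin m → Bool} {p : Fin n → ℝ} {μ : Fin m → (Fin k → Bool) → ℝ}
    (h : PairwiseLaws I y p μ) {j₀ : Fin m} (hinj : Function.Injective (I.vars j₀)) {F : Finset (Fin n)}
    (hF : F ⊆ varSet I j₀) (h2 : k ≤ F.card + 2) (x : Fin n → Bool) :
    ∑ β ∈ cylOff F x, mu I μ j₀ β = ∏ v ∈ varSet I j₀ \ F, rho (p v) (x v) := by
  have hQ : (univ.filter fun s => I.vars j₀ s ∉ F).card ≤ 2 := by
    rw [card_slots_not_mem hinj hF]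
    omega
  have htot : ∑ u, μ j₀ u = 1 := h.total j₀
  unfold mu
  rw [sum_cylOff_comp hinj hF x (μ j₀)]
  refine (sum_fix htot (h.marg j₀) (h.indep j₀) _ hQ (fun s => x (I.vars j₀ s))).trans ?_
  rw [← image_slots_not_mem I j₀ F, prod_image fun s _ t _ h => hinj h]

end Summit.PneNP.PneNP.Theorems.PairwiseSA
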